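import Mathlib
import Literature.Analysis.FluidPDE.KNSSPoloidalAxisDecay
import Literature.Analysis.FluidPDE.AxisymQuotientRayAverage
import Literature.Analysis.FluidPDE.TaoLocalisationHolds
import Literature.Analysis.FluidPDE.VorticityCalculus
import Summits.NavierStokesRegularity.NavierStokesRegularity.Theses.VorticityPace
import HarnessLib

/-!
# `VorticityPace.SwirlIsVortical` — swirl is always vortical
  (item stmt-NavierStokesRegularity-7783)

**Statement.** `ν > 0`, `T > 0`, `(u, p)` classical on `ℝ³ × [0, T)`, Leray–Hopf on `[0, T]` from
a rapidly decaying datum, axisymmetric on `[0, T)`, with `|Γ₀| = |swirl (u 0)| ≤ C`. Then for every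
`t ∈ [0, T)`, every `x` and every `δ > 0` there is `x'` with
`2 u_θ(t, x)² ≤ C ‖curl u(t)(x')‖ + δ`.

PROOF (the item's docstring; `x'` is an actual maximiser, `δ` is not needed).
1. *Maximum principle for the swirl* `Γ = r u_θ`: `|Γ(t, x)| ≤ C` on `[0, T)` — the tree's
   `abs_swirl_le_of_classical_Ico` (Chae–Lee 2002, KNSS 2009 (1.9)), whose hypothesis "bounded on
   every sub-slab `[0, T']`" is supplied by Tao's class (`tao2011_hasBoundedSobolevNormsOn_holds` +
   Sobolev embedding). Hence `|u_θ| ≤ C / r` off the axis.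
2. *Axial vorticity controls the swirl*: `Γ(x) = r² ∫₀¹ s ω_z(s x_h, x₃) ds` — the tree's radial
   quotient calculus (`cylRadius_sq_mul_radQuot_of_axis`, `IsAxisymmetric.radDerivQuot_swirl_eq`:
   `radDerivQuot Γ = (curl u)₂`, classically `ω_z = (1/r)∂ᵣ(r u_θ)`); so with `x'` a maximiser of
   `‖curl u(t)‖` on the horizontal segment from the axis to `x`, `|Γ(x)| ≤ r² ‖ω(x')‖ / 2`, i.e.
   `|u_θ| ≤ (r/2) ‖ω(x')‖` (this replaces the Stokes-on-a-disc step of the docstring).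
3. Multiply: `2 u_θ² ≤ 2 (C/r)(r ‖ω(x')‖/2) = C ‖ω(x')‖`. On the axis `u_θ = 0`.

HONEST FRAMING: an elementary unconditional estimate for HYPOTHETICAL axisymmetric classical
solutions; nothing here bears on the regularity problem itself.
-/

noncomputable section

set_option linter.dupNamespace false

namespace Summit.NavierStokesRegularity.NavierStokesRegularity.Theorems

open MeasureTheory Set Filter Topology Metric Function Literature.Analysis.FluidPDE
open scoped NNReal ENNReal

namespace SwirlIsVortical

variable {u : EuclideanSpace ℝ (Fin 3) → EuclideanSpace ℝ (Fin 3)}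

/-- **The axial vorticity on the segment to the axis controls the swirl**: for an axisymmetric
smooth `u` and any `x`, if `‖curl u (scaleH s x)‖ ≤ M` for `s ∈ [0, 1]`, then
`|Γ(x)| ≤ r² M / 2` (`Γ = r² · radQuot Γ`, `radQuot Γ(x) = ∫₀¹ s (curl u)₂(scaleH s x) ds`).
[cite: KNSS2009, (1.5)–(1.9) (cylindrical vorticity ω_z = (1/r)∂ᵣ(r u_θ))] -/
theorem abs_swirl_le_of_segment_bound (hax : IsAxisymmetric u) (hu : ContDiff ℝ (⊤ : ℕ∞) u)
    (x : EuclideanSpace ℝ (Fin 3)) {M : ℝ}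
    (hM : ∀ s ∈ Icc (0 : ℝ) 1, ‖curl u (scaleH s x)‖ ≤ M) :
    |swirl u x| ≤ cylRadius x ^ 2 * M / 2 := by
  have hS : ContDiff ℝ (⊤ : ℕ∞) (swirl u) := contDiff_swirl hu
  have hc2 : ContDiff ℝ 2 u := hu.of_le (by norm_cast)
  have hc1 : ContDiff ℝ 1 u := hu.of_le (by norm_cast)
  have hrd : radDerivQuot (swirl u) = fun y => curl u y 2 := hax.radDerivQuot_swirl_eq hc2
  -- the ray-average bound `|radQuot Γ x| ≤ M/2`
  have h1 := norm_iteratedFDeriv_radQuot_le hS 0 x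
  simp_rw [norm_iteratedFDeriv_zero] at h1
  rw [Real.norm_eq_abs, hrd] at h1
  have hωc : Continuous (curl u) := continuous_curl hc1
  have hfc : Continuous fun s : ℝ => s * ‖curl u (scaleH s x) 2‖ :=
    continuous_id.mul ((contDiff_piLp_apply (𝕜 := ℝ) (p := 2) (n := 0)
      (i := (2 : Fin 3))).continuous.comp (hωc.comp (continuous_scaleH_left x))).norm
  have hmono := intervalIntegral.integral_mono_on (μ := volume) (g := fun s => s * M) zero_le_one
    (hfc.intervalIntegrable 0 1) ((continuous_id.mul continuous_const).intervalIntegrable 0 1)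
    (fun s hs => mul_le_mul_of_nonneg_left
      ((PiLp.norm_apply_le (curl u (scaleH s x)) 2).trans (hM s hs)) hs.1)
  rw [intervalIntegral.integral_mul_const, integral_id] at hmono
  have hrq : |radQuot (swirl u) x| ≤ M / 2 := by
    refine h1.trans (hmono.trans (le_of_eq ?_))
    ring
  -- `Γ = r² · radQuot Γ`
  have hrep : cylRadius x ^ 2 * radQuot (swirl u) x = swirl u x :=
    cylRadius_sq_mul_radQuot_of_axis (hS.of_le (by norm_cast))
      hax.isAxisymmetricScalar_swirl (fun y hy => swirl_eq_zero_of_cylRadius_eq_zero _ hy) x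
  rw [← hrep, abs_mul, abs_of_nonneg (sq_nonneg _), mul_div_assoc]
  exact mul_le_mul_of_nonneg_left hrq (sq_nonneg _)

/-- **Sub-slab sup bounds** for a classical Leray–Hopf solution from a rapidly decaying datum
(Tao's class + Sobolev embedding), in the form consumed by the swirl maximum principle
`abs_swirl_le_of_classical_Ico`. [cite: Tao2011, Cor. 11.1 (arXiv Cor. 68)] -/
theorem subslab_bounded {ν T : ℝ} (hν : 0 < ν) (hT : 0 < T)
    {u : ℝ → EuclideanSpace ℝ (Fin 3) → EuclideanSpace ℝ (Fin 3)}
    {p : ℝ → EuclideanSpace ℝ (Fin 3) → ℝ}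
    (hsol : IsClassicalNSSolutionOn (Ico 0 T) ν 0 u p) (hLH : IsLerayHopfOn T ν 0 (u 0) u)
    (hdec : HasRapidSpatialDecay (u 0)) :
    ∀ T' < T, ∃ V : ℝ, ∀ t ∈ Icc 0 T', ∀ x, ‖u t x‖ ≤ V := by
  intro T' hT'
  set T'' : ℝ := max T' (T / 2) with hT''def
  have hT'' : T'' ∈ Ioo 0 T := ⟨lt_max_of_lt_right (by linarith), max_lt hT' (by linarith)⟩
  have hsolc : IsClassicalNSSolutionOn (Icc 0 T'') ν 0 u p :=
    hsol.mono (Icc_subset_Ico_right hT''.2) (uniqueDiffOn_Icc hT''.1)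
  have hE : ∃ C : ℝ≥0, ∀ t ∈ Icc 0 T'', ∫⁻ x, ‖u t x‖ₑ ^ 2 ≤ C :=
    ⟨(2 * VectorCalculus.kineticEnergy (u 0)).toNNReal, fun t ht =>
      hLH.lintegral_enorm_sq_le hν.le ⟨ht.1, ht.2.trans hT''.2.le⟩⟩
  have hB : HasBoundedSobolevNormsOn (Icc 0 T'') u :=
    tao2011_hasBoundedSobolevNormsOn_holds hν hT''.1 hsolc hE hdec
  obtain ⟨V, -, hV⟩ := hB.exists_forall_norm_iteratedFDeriv_le
    (fun t ht => hsolc.contDiff_velocity ht) 0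
  refine ⟨V, fun t ht x => ?_⟩
  have h := hV t ⟨ht.1, ht.2.trans (le_max_left _ _)⟩ x
  rwa [norm_iteratedFDeriv_zero] at h

end SwirlIsVortical

open SwirlIsVortical in
/-- **Item stmt-NavierStokesRegularity-7783** (`VorticityPace.SwirlIsVortical`): for an
axisymmetric classical Leray–Hopf solution from a rapidly decaying datum with `|Γ₀| ≤ C`,
`2 u_θ(t,x)² ≤ C ‖curl u(t)(x')‖ + δ` for some `x'` (a maximiser of `‖curl u(t)‖` on the horizontal
segment from the axis to `x`). [cite: ChaeLee2002, §1 (swirl maximum principle)] -/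
theorem vorticityPace_swirlIsVortical_proof :
    Summit.NavierStokesRegularity.NavierStokesRegularity.Theses.VorticityPace.SwirlIsVortical := by
  unfold Summit.NavierStokesRegularity.NavierStokesRegularity.Theses.VorticityPace.SwirlIsVortical
  intro ν T hν hT u p hsol hLH hdec haxi C hC t ht x δ hδ
  -- maximum principle for the swirl
  have hΓ : |swirl (u t) x| ≤ C :=
    abs_swirl_le_of_classical_Ico hν hsol haxi (subslab_bounded hν hT hsol hLH hdec) hC t ht x
  have hC0 : 0 ≤ C := (abs_nonneg _).trans (hC 0)
  have hu : ContDiff ℝ (⊤ : ℕ∞) (u t) := hsol.contDiff_velocity ht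
  have hωc : Continuous (curl (u t)) :=
    continuous_curl (hu.of_le (by norm_cast))
  -- a maximiser of `‖curl u(t)‖` on the segment `s ↦ scaleH s x`, `s ∈ [0, 1]`
  obtain ⟨s₀, -, hmax⟩ := isCompact_Icc.exists_isMaxOn (nonempty_Icc.2 (zero_le_one' ℝ))
    ((hωc.comp (continuous_scaleH_left x)).norm.continuousOn :
      ContinuousOn (fun s : ℝ => ‖curl (u t) (scaleH s x)‖) (Icc 0 1))
  set M : ℝ := ‖curl (u t) (scaleH s₀ x)‖ with hMdef
  have hM0 : 0 ≤ M := norm_nonneg _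
  have hseg : |swirl (u t) x| ≤ cylRadius x ^ 2 * M / 2 :=
    abs_swirl_le_of_segment_bound (haxi t ht) hu x fun s hs => hmax hs
  refine ⟨scaleH s₀ x, ?_⟩
  by_cases hρ : cylRadius x = 0
  · -- on the axis `u_θ = 0`
    have h0 : swirlVelocity (u t) x = 0 := by
      simp [swirlVelocity, eTheta, hρ]
    rw [h0]
    nlinarith
  · have hρpos : 0 < cylRadius x := lt_of_le_of_ne (cylRadius_nonneg x) (Ne.symm hρ)
    have hsv : swirlVelocity (u t) x = swirl (u t) x / cylRadius x := by
      rw [swirl_eq_cylRadius_mul_swirlVelocity _ hρ, mul_div_cancel_left₀ _ hρ]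
    have h1 : |swirlVelocity (u t) x| ≤ C / cylRadius x := by
      rw [hsv, abs_div, abs_of_pos hρpos]
      exact div_le_div_of_nonneg_right hΓ hρpos.le
    have h2 : |swirlVelocity (u t) x| ≤ cylRadius x * M / 2 := by
      rw [hsv, abs_div, abs_of_pos hρpos, div_le_iff₀ hρpos]
      calc |swirl (u t) x| ≤ cylRadius x ^ 2 * M / 2 := hseg
        _ = cylRadius x * M / 2 * cylRadius x := by ring
    have h3 : |swirlVelocity (u t) x| * |swirlVelocity (u t) x| ≤
        (C / cylRadius x) * (cylRadius x * M / 2) :=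
      mul_le_mul h1 h2 (abs_nonneg _) (by positivity)
    calc 2 * swirlVelocity (u t) x ^ 2
        = 2 * (|swirlVelocity (u t) x| * |swirlVelocity (u t) x|) := by
          rw [← sq, sq_abs]
      _ ≤ 2 * ((C / cylRadius x) * (cylRadius x * M / 2)) := by linarith
      _ = C * M := by field_simp
      _ ≤ C * ‖curl (u t) (scaleH s₀ x)‖ + δ := by rw [hMdef]; linarith

end Summit.NavierStokesRegularity.NavierStokesRegularity.Theorems

end
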